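import Mathlib

/-!
# Comb lemma, layer 0: the interpolation functional of a sheet family

Pure real analysis used by the corrected comb lemma (line `heteroclinic_comb` of crux
`LaminatedThreshold`): from a strictly decreasing family of continuous sheets `H k : X → ℝ`
converging uniformly to `H∞`, build `Ψ : X × ℝ → ℝ`, continuous, with `Ψ = 0` exactly below `H∞`,
`Ψ = 1` above `H 0`, and `Ψ (x, t) = 2⁻ᵐ` (`m ≥ 1`) exactly on the sheet `t = H m x`:
`Ψ (x, t) = ∑ₖ 2^{-(k+1)} ramp_k (x, t)` with `ramp_k` the affine ramp from sheet `k + 1` to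
sheet `k`, clamped to `[0, 1]`.
-/

set_option linter.dupNamespace false

namespace Summit.FinalStateConjecture.FinalStateConjecture.Theorems.LaminatedThreshold.Comb

open Set Filter Topology


variable {X : Type*} [TopologicalSpace X]

omit [TopologicalSpace X] in
/-- Antitonicity of a strictly decreasing sheet family. [folklore] -/
theorem sheet_antitone (S : Set X) (H : ℕ → X → ℝ) (hdec : ∀ k, ∀ x ∈ S, H (k + 1) x < H k x)
    {x : X} (hx : x ∈ S) {m k : ℕ} (hmk : m ≤ k) : H k x ≤ H m x := by
  induction k with
  | zero => simp [Nat.le_zero.1 hmk]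
  | succ k ih =>
    rcases Nat.of_le_succ hmk with h | h
    · exact ((hdec k x hx).le).trans (ih h)
    · rw [h]

omit [TopologicalSpace X] in
/-- The uniform limit of a strictly decreasing sheet family lies strictly below every sheet.
[folklore] -/
theorem limit_lt_sheet (S : Set X) (H : ℕ → X → ℝ) (Hinf : X → ℝ)
    (hdec : ∀ k, ∀ x ∈ S, H (k + 1) x < H k x) (hlim : TendstoUniformlyOn H Hinf atTop S)
    {x : X} (hx : x ∈ S) (k : ℕ) : Hinf x < H k x := by
  have hpt : Tendsto (fun n ↦ H n x) atTop (𝓝 (Hinf x)) := hlim.tendsto_at hx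
  have hle : Hinf x ≤ H (k + 1) x := by
    refine le_of_tendsto hpt (Filter.eventually_atTop.2 ⟨k + 1, fun n hn ↦ ?_⟩)
    exact sheet_antitone S H hdec hx hn
  exact hle.trans_lt (hdec k x hx)

/-- **The interpolation functional of a sheet family.** [folklore] -/
theorem exists_interpolation : ∀ {X : Type*} [TopologicalSpace X] (S : Set X) (H : ℕ → X → ℝ) (Hinf : X → ℝ), (∀ k, ContinuousOn (H k) S) → (∀ k, ∀ x ∈ S, H (k + 1) x < H k x) → TendstoUniformlyOn H Hinf Filter.atTop S → ∃ Ψ : X × ℝ → ℝ, ContinuousOn Ψ (S ×ˢ Set.univ) ∧ (∀ x ∈ S, ∀ t, Ψ (x, t) ∈ Set.Icc (0 : ℝ) 1) ∧ (∀ x ∈ S, ∀ t, Ψ (x, t) = 0 ↔ t ≤ Hinf x) ∧ (∀ x ∈ S, ∀ t, ∀ m, 1 ≤ m → (Ψ (x, t) = (1 / 2 : ℝ) ^ m ↔ t = H m x)) := by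
  intro X _ S H Hinf hcont hdec hlim
  -- the ramps and the functional
  set R : ℕ → X × ℝ → ℝ := fun k p ↦
    max 0 (min 1 ((p.2 - H (k + 1) p.1) / (H k p.1 - H (k + 1) p.1))) with hR
  set Ψ : X × ℝ → ℝ := fun p ↦ ∑' k, (1 / 2 : ℝ) ^ (k + 1) * R k p with hΨ
  -- elementary facts about the clamped ramp `r ↦ max 0 (min 1 r)`
  have clamp_mem : ∀ r : ℝ, max 0 (min 1 r) ∈ Icc (0 : ℝ) 1 := fun r ↦
    ⟨le_max_left _ _, max_le zero_le_one (min_le_left _ _)⟩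
  have clamp_mono : Monotone fun r : ℝ ↦ max 0 (min 1 r) :=
    fun _ _ h ↦ max_le_max le_rfl (min_le_min le_rfl h)
  have clamp_of_nonpos : ∀ {r : ℝ}, r ≤ 0 → max 0 (min 1 r) = 0 := fun h ↦
    max_eq_left ((min_le_right _ _).trans h)
  have clamp_of_one_le : ∀ {r : ℝ}, 1 ≤ r → max 0 (min 1 r) = 1 := fun h ↦ by
    rw [min_eq_left h, max_eq_right zero_le_one]
  have clamp_of_mem : ∀ {r : ℝ}, r ∈ Icc (0 : ℝ) 1 → max 0 (min 1 r) = r := fun h ↦ by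
    rw [min_eq_right h.2, max_eq_right h.1]
  have clamp_pos : ∀ {r : ℝ}, 0 < r → 0 < max 0 (min 1 r) := fun h ↦
    lt_max_of_lt_right (lt_min zero_lt_one h)
  have continuous_clamp : Continuous fun r : ℝ ↦ max 0 (min 1 r) :=
    continuous_const.max (continuous_const.min continuous_id)
  have hRmem : ∀ k p, R k p ∈ Icc (0 : ℝ) 1 := fun k p ↦ clamp_mem _
  have hgeom : Summable fun k : ℕ ↦ (1 / 2 : ℝ) ^ (k + 1) :=
    (summable_nat_add_iff 1).2 summable_geometric_two
  have hgeom1 : ∑' k : ℕ, (1 / 2 : ℝ) ^ (k + 1) = 1 := by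
    have h2 : ∀ k : ℕ, (1 / 2 : ℝ) ^ (k + 1) = 1 / 2 * (1 / 2 : ℝ) ^ k := fun k ↦ by ring
    rw [tsum_congr h2, tsum_mul_left, tsum_geometric_two]
    norm_num
  have hterm_nonneg : ∀ k p, 0 ≤ (1 / 2 : ℝ) ^ (k + 1) * R k p :=
    fun k p ↦ mul_nonneg (by positivity) (hRmem k p).1
  have hterm_le : ∀ k p, (1 / 2 : ℝ) ^ (k + 1) * R k p ≤ (1 / 2 : ℝ) ^ (k + 1) :=
    fun k p ↦ mul_le_of_le_one_right (by positivity) (hRmem k p).2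
  have hsumm : ∀ p, Summable fun k ↦ (1 / 2 : ℝ) ^ (k + 1) * R k p :=
    fun p ↦ Summable.of_nonneg_of_le (hterm_nonneg · p) (hterm_le · p) hgeom
  -- positivity of the gaps between consecutive sheets
  have hgap : ∀ k, ∀ x ∈ S, 0 < H k x - H (k + 1) x := fun k x hx ↦ sub_pos.2 (hdec k x hx)
  -- continuity
  have hΨcont : ContinuousOn Ψ (S ×ˢ univ) := by
    refine continuousOn_tsum (fun k ↦ ?_) hgeom fun k p _ ↦ ?_
    · have h1 : ContinuousOn (fun p : X × ℝ ↦ H (k + 1) p.1) (S ×ˢ univ) :=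
        (hcont (k + 1)).comp continuousOn_fst fun p hp ↦ hp.1
      have h0 : ContinuousOn (fun p : X × ℝ ↦ H k p.1) (S ×ˢ univ) :=
        (hcont k).comp continuousOn_fst fun p hp ↦ hp.1
      have hq : ContinuousOn (fun p : X × ℝ ↦ (p.2 - H (k + 1) p.1) / (H k p.1 - H (k + 1) p.1))
          (S ×ˢ univ) :=
        (continuousOn_snd.sub h1).div (h0.sub h1) fun p hp ↦ (hgap k p.1 hp.1).ne'
      exact continuousOn_const.mul (continuous_clamp.comp_continuousOn hq)
    · rw [Real.norm_eq_abs, abs_of_nonneg (hterm_nonneg k p)]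
      exact hterm_le k p
  -- range
  have hΨmem : ∀ p, Ψ p ∈ Icc (0 : ℝ) 1 := fun p ↦
    ⟨tsum_nonneg (hterm_nonneg · p),
      hgeom1 ▸ (hsumm p).tsum_le_tsum (hterm_le · p) hgeom⟩
  -- monotonicity in the real variable
  have hRmono : ∀ k, ∀ x ∈ S, Monotone fun t : ℝ ↦ R k (x, t) := by
    intro k x hx t t' htt'
    exact clamp_mono (div_le_div_of_nonneg_right (by linarith) (hgap k x hx).le)
  have hΨmono : ∀ x ∈ S, Monotone fun t : ℝ ↦ Ψ (x, t) := fun x hx t t' htt' ↦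
    (hsumm (x, t)).tsum_le_tsum (fun k ↦ mul_le_mul_of_nonneg_left (hRmono k x hx htt')
      (by positivity)) (hsumm (x, t'))
  -- below the limit sheet every ramp vanishes
  have hRzero : ∀ k, ∀ x ∈ S, ∀ t, t ≤ H (k + 1) x → R k (x, t) = 0 := by
    intro k x hx t ht
    exact clamp_of_nonpos (div_nonpos_of_nonpos_of_nonneg (by linarith) (hgap k x hx).le)
  have hΨzero : ∀ x ∈ S, ∀ t, t ≤ Hinf x → Ψ (x, t) = 0 := by
    intro x hx t ht
    have hk : ∀ k, (1 / 2 : ℝ) ^ (k + 1) * R k (x, t) = 0 := fun k ↦ by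
      rw [hRzero k x hx t (ht.trans (limit_lt_sheet S H Hinf hdec hlim hx (k + 1)).le),
        mul_zero]
    show ∑' k, (1 / 2 : ℝ) ^ (k + 1) * R k (x, t) = 0
    rw [tsum_congr hk, tsum_zero]
  -- above the limit sheet the functional is positive
  have hΨpos : ∀ x ∈ S, ∀ t, Hinf x < t → 0 < Ψ (x, t) := by
    intro x hx t ht
    have hpt : Tendsto (fun n ↦ H n x) atTop (𝓝 (Hinf x)) := hlim.tendsto_at hx
    obtain ⟨n, hn⟩ := (Filter.eventually_atTop.1 ((tendsto_order.1 hpt).2 t ht))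
    have hlt : H (n + 1) x < t := hn (n + 1) (Nat.le_succ n)
    have hRpos : 0 < R n (x, t) := clamp_pos (div_pos (by linarith) (hgap n x hx))
    exact (hsumm (x, t)).tsum_pos (hterm_nonneg · (x, t)) n (mul_pos (by positivity) hRpos)
  -- on and above the top sheet the functional equals one
  have hRone : ∀ k, ∀ x ∈ S, ∀ t, H k x ≤ t → R k (x, t) = 1 := by
    intro k x hx t ht
    refine clamp_of_one_le ((one_le_div (hgap k x hx)).2 ?_)
    show H k x - H (k + 1) x ≤ t - H (k + 1) x
    linarith
  have hΨone : ∀ x ∈ S, ∀ t, H 0 x ≤ t → Ψ (x, t) = 1 := by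
    intro x hx t ht
    have hk : ∀ k, (1 / 2 : ℝ) ^ (k + 1) * R k (x, t) = (1 / 2 : ℝ) ^ (k + 1) := fun k ↦ by
      rw [hRone k x hx t ((sheet_antitone S H hdec hx (Nat.zero_le k)).trans ht), mul_one]
    show ∑' k, (1 / 2 : ℝ) ^ (k + 1) * R k (x, t) = 1
    rw [tsum_congr hk, hgeom1]
  -- the value on the sheet `H m`
  have hΨsheet : ∀ x ∈ S, ∀ m, Ψ (x, H m x) = (1 / 2 : ℝ) ^ m := by
    intro x hx m
    have hsplit := (hsumm (x, H m x)).sum_add_tsum_nat_add m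
    have hfin : ∑ i ∈ Finset.range m, (1 / 2 : ℝ) ^ (i + 1) * R i (x, H m x) = 0 := by
      refine Finset.sum_eq_zero fun i hi ↦ ?_
      rw [Finset.mem_range] at hi
      rw [hRzero i x hx _ (sheet_antitone S H hdec hx (Nat.succ_le_of_lt hi)), mul_zero]
    have htail : ∀ i, (1 / 2 : ℝ) ^ (i + m + 1) * R (i + m) (x, H m x)
        = (1 / 2 : ℝ) ^ m * (1 / 2 : ℝ) ^ (i + 1) := fun i ↦ by
      rw [hRone (i + m) x hx _ (sheet_antitone S H hdec hx (Nat.le_add_left m i)), mul_one,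
        ← pow_add]
      congr 1
      ring
    show ∑' k, (1 / 2 : ℝ) ^ (k + 1) * R k (x, H m x) = (1 / 2 : ℝ) ^ m
    rw [← hsplit, hfin, zero_add, tsum_congr htail, tsum_mul_left, hgeom1, mul_one]
  -- strict monotonicity between the limit sheet and the top sheet
  have hΨstrict : ∀ x ∈ S, ∀ t t', Hinf x < t → t < H 0 x → t < t' → Ψ (x, t) < Ψ (x, t') := by
    intro x hx t t' hinf htop htt'
    -- the ramp index `k` with `H (k+1) x ≤ t < H k x`
    have hex : ∃ k, H (k + 1) x ≤ t := by
      have hpt : Tendsto (fun n ↦ H n x) atTop (𝓝 (Hinf x)) := hlim.tendsto_at hx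
      obtain ⟨n, hn⟩ := (Filter.eventually_atTop.1 ((tendsto_order.1 hpt).2 t hinf))
      exact ⟨n, (hn (n + 1) (Nat.le_succ n)).le⟩
    classical
    let k := Nat.find hex
    have hk₁ : H (k + 1) x ≤ t := Nat.find_spec hex
    have hk₂ : t < H k x := by
      rcases Nat.eq_zero_or_eq_succ_pred k with h0 | hsucc
      · rw [h0]; exact htop
      · have hmin := Nat.find_min hex (m := k - 1) (by omega)
        rw [hsucc]
        push Not at hmin
        have : k - 1 + 1 = k.pred.succ := by omega
        rw [this] at hmin
        exact hmin
    set t'' : ℝ := min t' (H k x) with ht''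
    have htt'' : t < t'' := lt_min htt' hk₂
    have ht''le : t'' ≤ t' := min_le_left _ _
    have hratio : ∀ s, H (k + 1) x ≤ s → s ≤ H k x →
        R k (x, s) = (s - H (k + 1) x) / (H k x - H (k + 1) x) := by
      intro s hs₁ hs₂
      refine clamp_of_mem ⟨div_nonneg (by linarith) (hgap k x hx).le, ?_⟩
      exact (div_le_one (hgap k x hx)).2 (by linarith)
    have hRlt : R k (x, t) < R k (x, t'') := by
      rw [hratio t hk₁ hk₂.le, hratio t'' (hk₁.trans htt''.le) (min_le_right _ _)]
      exact div_lt_div_of_pos_right (by linarith) (hgap k x hx)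
    have hRlt' : R k (x, t) < R k (x, t') := hRlt.trans_le (hRmono k x hx ht''le)
    exact Summable.tsum_lt_tsum (i := k) (fun j ↦ mul_le_mul_of_nonneg_left
      (hRmono j x hx htt'.le) (by positivity)) (mul_lt_mul_of_pos_left hRlt' (by positivity))
      (hsumm (x, t)) (hsumm (x, t'))
  -- assembling
  refine ⟨Ψ, hΨcont, fun x _ t ↦ hΨmem (x, t), fun x hx t ↦ ⟨fun h0 ↦ ?_, hΨzero x hx t⟩,
    fun x hx t m hm ↦ ⟨fun hval ↦ ?_, fun ht ↦ ht ▸ hΨsheet x hx m⟩⟩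
  · by_contra hlt
    push Not at hlt
    exact (hΨpos x hx t hlt).ne' h0
  · have hhalf_lt_one : (1 / 2 : ℝ) ^ m < 1 := pow_lt_one₀ (by norm_num) (by norm_num) (by omega)
    have hhalf_pos : 0 < (1 / 2 : ℝ) ^ m := by positivity
    have hinf : Hinf x < t := by
      by_contra hle
      push Not at hle
      rw [hΨzero x hx t hle] at hval
      exact hhalf_pos.ne hval
    have htop : t < H 0 x := by
      by_contra hle
      push Not at hle
      rw [hΨone x hx t hle] at hval
      exact hhalf_lt_one.ne' hval
    have hminf : Hinf x < H m x := limit_lt_sheet S H Hinf hdec hlim hx m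
    have hmtop : H m x < H 0 x := by
      obtain ⟨m', rfl⟩ := Nat.exists_eq_succ_of_ne_zero (by omega : m ≠ 0)
      exact (hdec m' x hx).trans_le (sheet_antitone S H hdec hx (Nat.zero_le m'))
    rcases lt_trichotomy t (H m x) with hlt | heq | hgt
    · have := hΨstrict x hx t (H m x) hinf htop hlt
      rw [hval, hΨsheet x hx m] at this
      exact absurd this (lt_irrefl _)
    · exact heq
    · have := hΨstrict x hx (H m x) t hminf hmtop hgt
      rw [hval, hΨsheet x hx m] at this
      exact absurd this (lt_irrefl _)

end Summit.FinalStateConjecture.FinalStateConjecture.Theorems.LaminatedThreshold.Comb
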